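import Summits.BirchSwinnertonDyer.BirchSwinnertonDyer.Theorems.UniversalToricDescentThinCombNodeSeries
import Literature.NumberTheory.EllipticCurves.IntSeriesIdentityPrinciple
import HarnessLib

/-!
# COLUMN TWIST: two `R₀⟦T₁⟧⟦T₂⟧`-series whose values on a monomial grid differ by `w^{j+1}` along the SECOND variable differ there by a
# binomial power `w = (1 + (v₂ − 1))^e`, `e ∈ ℤ_p` (the second-variable node theorem)
# (helper on the rational wall `RationalSplitIMCInclusionAtThree`, stmt-BirchSwinnertonDyer-24207, line `ratwall_thin_comb`;
# cell `pub/bsd-wall`, LEAD `cruxlead-24207` g38; `--supports stmt-BirchSwinnertonDyer-24207`; nothing is closed; BSD is not proved)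

WHY THIS FILE. `…ThinComb.WildRigidity` (g37) reads the tree's one-variable `ℂ_p` NODE THEOREM
(`Literature…LocalFields.PadicComplex.exists_padicInt_binomial_twist_of_node_values`: node-proportional values `g(uᵗ − 1) = c·dᵗ·f(uᵗ − 1)`
force `g = Q·f`, `(1+X)Q′ = zQ`, `z ∈ ℤ_p`) along the FIBRES `T₂ = y_j` of the grid supply, i.e. in the first variable. The FRAME FUNCTIONAL
EQUATION (`…ThinComb.FrameFunctionalEquation`, this gen) needs the same theorem in the SECOND variable: after twisting the reflected frame by
the group-like element that kills the first-variable ratio, the values of the two series `G`, `L` at the grid points `(x_{ij}, y_j)`,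
`y_j = v₂^{j+1} − 1`, differ by a factor `w^{j+1}` depending on the fibre ONLY. This file proves that then `w = Q(v₂ − 1)` for a normalised
binomial series `Q` (`(1+X)Q′ = eQ`, `Q(0) = 1`, `Q` integral, `e ∈ ℤ_p`) — provided `L ≠ 0`:

* §1 `hasValueAt_C_mul` — values of `C a · F` (one variable).
* §2 **`exists_binomial_of_column_twist`**. PROOF: on each fibre `j` the lines `T₂ = y_j` of `G` and of `L` (`IntSeries.lineSubst y_j (·)ᵗ`)
  take proportional values `w^{j+1}·V` at the infinitely many nodes `x_{ij}` of the closed disc `‖x‖ ≤ |p|`, so they are proportional as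
  series (identity principle, `IntSeries.eq_of_infinite_hasValueAt_eq`); their `n`-th coefficients are the values at `y_j` of the inner
  coefficient series `[T₁ⁿ]G`, `[T₁ⁿ]L ∈ R₀⟦T₂⟧` (`IntSeries.hasValueAt_coeff_transpose`), so `[T₁ⁿ]G (y_j) = w^{j+1}·[T₁ⁿ]L (y_j)` for all
  `n, j`; for an `n₀` with `[T₁^{n₀}]L ≠ 0` the node values of `[T₁^{n₀}]L` are non-zero beyond some `j₁` (finitely many zeros on the closed
  disc, `…NodeSeries.exists_forall_le_ne_zero`); re-centring at the node `j₁` (`…NodeSeries.exists_recenter_rescale`, offset `a = v₂^{j₁+1}`)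
  gives integral `H, H′ ∈ ℂ_p⟦X⟧` with `H′(v₂ᵗ − 1) = w^{j₁+1}·wᵗ·H(v₂ᵗ − 1)`; the node theorem gives `H′ = Q·H`; evaluation at `t = 0, 1`
  gives `Q(0) = w^{j₁+1}`, `Q(v₂ − 1) = w^{j₁+2}`; normalise by `Q(0)`.

HONEST SCOPE: elementary non-archimedean analysis (general `p`); nothing here is evidence that a toric frame exists at the additive split `3`;
24207 / 20395 / 20186 / 32493 OPEN; BSD is proved for no curve.

References: [cite: Robert2000PadicAnalysis, Ch. V §2.4 Theorem 1; Ch. VI §2.1–2.4] [cite: Gouvea1993PadicNumbers, §5.6 Cor. 5.6.3–5.6.4; §5.9 Problem 194]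
[cite: deShalit1987, II.4.17 (54) (lines of two-variable series)]
-/

set_option linter.dupNamespace false
set_option autoImplicit false

noncomputable section

open scoped Classical
open Filter Topology PowerSeries

namespace Summit.BirchSwinnertonDyer.BirchSwinnertonDyer.Theorems.UniversalToricDescentThinComb.ColumnTwist

open Literature.NumberTheory.EllipticCurves Literature.NumberTheory.LocalFields
open Summit.BirchSwinnertonDyer.BirchSwinnertonDyer.Theorems.UniversalToricDescentThinComb

variable {p : ℕ} [Fact p.Prime]

/-! ### §1. Values of a constant multiple -/

/-- Values of `C a · F` are `a` times the values of `F` (one variable, `𝒪_{ℂ_p}`-coefficients). [folklore] -/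
theorem hasValueAt_C_mul {F : PowerSeries (PadicComplexInt p)} (a : PadicComplexInt p) {x v : ℂ_[p]}
    (hF : IntSeries.HasValueAt F x v) : IntSeries.HasValueAt (C a * F) x ((a : ℂ_[p]) * v) := by
  unfold IntSeries.HasValueAt at *
  refine (hF.mul_left (a : ℂ_[p])).congr_fun fun k ↦ ?_
  rw [coeff_C_mul]
  push_cast
  ring

/-- The value of a series at `0` is its constant coefficient. [folklore] -/
theorem tsum_coeff_mul_zero_pow {R : Type*} [NormedField R] (Q : PowerSeries R) :
    ∑' n, coeff n Q * (0 : R) ^ n = constantCoeff Q := by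
  rw [tsum_eq_single 0 (fun n hn ↦ by rw [zero_pow hn, mul_zero])]
  simp

/-! ### §2. The column twist -/

/-- **COLUMN TWIST.** Let `G, L ∈ R₀⟦T₁⟧⟦T₂⟧`, `L ≠ 0`, let `v₂` be a one-unit of level `|p|` of infinite order, `y_j = v₂^{j+1} − 1`, and for
each `j` let `(x_{ij})_i` be an injective sequence in the closed disc `‖x‖ ≤ |p|`. If `L(x_{ij}, y_j) = V_{ij}` and `G(x_{ij}, y_j) = w^{j+1}·V_{ij}`
for all `i, j`, with `0 < ‖w‖ ≤ 1`, then `w = Q(v₂ − 1)` for an integral `Q ∈ ℂ_p⟦X⟧` with `(1 + X)·Q′ = e·Q`, `Q(0) = 1`, `e ∈ ℤ_p`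
(i.e. `w = v₂^e`). [cite: Robert2000PadicAnalysis, Ch. V §2.4 Theorem 1; Ch. VI §2.1, §2.4] [cite: Gouvea1993PadicNumbers, §5.6 Cor. 5.6.4; §5.9 Problem 194] -/
theorem exists_binomial_of_column_twist
    {G L : PowerSeries (UnrSeries p)} {x : ℕ → ℕ → ℂ_[p]} {v₂ w : ℂ_[p]} {VL : ℕ → ℕ → ℂ_[p]}
    (hx : ∀ i j, ‖x i j‖ ≤ ‖(p : ℂ_[p])‖) (hinjx : ∀ j, Function.Injective fun i ↦ x i j)
    (hv₂ : ‖v₂ - 1‖ < ‖(p : ℂ_[p])‖) (hv₂t : ∀ n : ℕ, 0 < n → v₂ ^ n ≠ 1)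
    (hw : ‖w‖ ≤ 1) (hw0 : w ≠ 0)
    (hVL : ∀ i j, UnrSeries.HasValueAt₂ L (x i j) (v₂ ^ (j + 1) - 1) (VL i j))
    (hVG : ∀ i j, UnrSeries.HasValueAt₂ G (x i j) (v₂ ^ (j + 1) - 1) (w ^ (j + 1) * VL i j))
    (hL0 : L ≠ 0) :
    ∃ (e : ℤ_[p]) (Q : PowerSeries ℂ_[p]),
      (1 + X) * derivative ℂ_[p] Q = C (((e : ℚ_[p]) : ℂ_[p])) * Q ∧
      constantCoeff Q = 1 ∧ (∀ n, ‖coeff n Q‖ ≤ 1) ∧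
      HasSum (fun n ↦ coeff n Q * (v₂ - 1) ^ n) w := by
  -- the disc `‖·‖ ≤ |p|` and the nodes `y_j = v₂^{j+1} − 1`
  have hp : p.Prime := Fact.out
  have h31 : ‖(p : ℂ_[p])‖ < 1 := by
    have h := norm_prime_padicComplex_lt_one (p := p); simpa using h
  have h30 : (p : ℂ_[p]) ≠ 0 := by exact_mod_cast hp.ne_zero
  have hc0 : 0 < ‖(p : ℂ_[p])‖ := norm_pos_iff.mpr h30
  have hv₂1 : ‖v₂ - 1‖ ≤ 1 := (hv₂.trans h31).le
  have hv₂_ne : v₂ ≠ 0 := fun h ↦ by rw [h, zero_sub, norm_neg, norm_one] at hv₂; exact (lt_irrefl _) (hv₂.trans h31)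
  set y : ℕ → ℂ_[p] := fun j ↦ v₂ ^ (j + 1) - 1 with hy_def
  have hyϖ : ∀ j : ℕ, ‖y j‖ ≤ ‖(p : ℂ_[p])‖ := fun j ↦
    ((RamifiedSevenEllipticUnits.LemmaXi.norm_pow_sub_one_le hv₂1 _).trans_lt hv₂).le
  have hy1 : ∀ j : ℕ, ‖y j‖ < 1 := fun j ↦ (hyϖ j).trans_lt h31
  have hx1 : ∀ i j, ‖x i j‖ < 1 := fun i j ↦ (hx i j).trans_lt h31
  have hinjy : Function.Injective y := by
    simpa only [hy_def, one_mul] using FibredSupply.injective_mul_pow_sub_one one_ne_zero hv₂_ne hv₂t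
  have hvt1 : ∀ t : ℕ, ‖v₂ ^ t - 1‖ ≤ ‖(p : ℂ_[p])‖ := fun t ↦
    ((RamifiedSevenEllipticUnits.LemmaXi.norm_pow_sub_one_le hv₂1 t).trans_lt hv₂).le
  have hwj : ∀ j : ℕ, ‖w ^ j‖ ≤ 1 := fun j ↦ by rw [norm_pow]; exact pow_le_one₀ (norm_nonneg _) hw
  -- the two series read in `𝒪_{ℂ_p}⟦T₁⟧⟦T₂⟧`
  set Gt := UnrSeries.toInt₂ G with hGt
  set Lt := UnrSeries.toInt₂ L with hLt
  have hLt0 : Lt ≠ 0 := fun h ↦ hL0 (UnrSeries.toInt₂_injective (by rw [← hLt, h, map_zero]))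
  set yI : ℕ → PadicComplexInt p := fun j ↦ ⟨y j, mem_padicComplexInt_iff.mpr (hy1 j).le⟩ with hyI
  have hyIc : ∀ j, ((yI j : PadicComplexInt p) : ℂ_[p]) = y j := fun _ ↦ rfl
  have hyI1 : ∀ j, ‖((yI j : PadicComplexInt p) : ℂ_[p])‖ < 1 := fun j ↦ hy1 j
  set wI : ℕ → PadicComplexInt p := fun j ↦ ⟨w ^ (j + 1), mem_padicComplexInt_iff.mpr (hwj _)⟩ with hwI
  have hwIc : ∀ j, ((wI j : PadicComplexInt p) : ℂ_[p]) = w ^ (j + 1) := fun _ ↦ rfl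
  -- §2a. the fibres `T₂ = y_j`: the lines of `G` and `L` are proportional by `w^{j+1}`
  have hline : ∀ j : ℕ,
      IntSeries.lineSubst (yI j) (IntSeries.transpose Gt) = C (wI j) * IntSeries.lineSubst (yI j) (IntSeries.transpose Lt) := by
    intro j
    refine IntSeries.eq_of_infinite_hasValueAt_eq h30 h31 ?_
    refine Set.infinite_of_injective_forall_mem (hinjx j) fun i ↦ ⟨hx i j, w ^ (j + 1) * VL i j, ?_, ?_⟩
    · exact (IntSeries.hasValueAt_lineSubst_transpose_iff Gt (hyI1 j) (hx1 i j) _).mpr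
        ((UnrSeries.hasValueAt₂_iff_toInt₂ G _ _ _).mp (hVG i j))
    · have h := hasValueAt_C_mul (wI j) ((IntSeries.hasValueAt_lineSubst_transpose_iff Lt (hyI1 j) (hx1 i j) _).mpr
        ((UnrSeries.hasValueAt₂_iff_toInt₂ L _ _ _).mp (hVL i j)))
      rwa [hwIc] at h
  -- §2b. the inner coefficient series `[T₁ⁿ]G`, `[T₁ⁿ]L ∈ 𝒪⟦T₂⟧` and their values at the nodes `y_j`
  set gv : ℕ → ℕ → ℂ_[p] := fun n j ↦ ((coeff n (IntSeries.lineSubst (yI j) (IntSeries.transpose Gt)) : PadicComplexInt p) : ℂ_[p])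
    with hgv
  set lv : ℕ → ℕ → ℂ_[p] := fun n j ↦ ((coeff n (IntSeries.lineSubst (yI j) (IntSeries.transpose Lt)) : PadicComplexInt p) : ℂ_[p])
    with hlv
  have hrel : ∀ n j, gv n j = w ^ (j + 1) * lv n j := by
    intro n j
    simp only [hgv, hlv]
    rw [hline j, coeff_C_mul]
    push_cast
    rw [hwIc]
  have hgval : ∀ n j, IntSeries.HasValueAt (coeff n Gt) (y j) (gv n j) := by
    intro n j
    have h := IntSeries.hasValueAt_coeff_transpose (IntSeries.transpose Gt) (hyI1 j) n
    rwa [IntSeries.transpose_transpose] at h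
  have hlval : ∀ n j, IntSeries.HasValueAt (coeff n Lt) (y j) (lv n j) := by
    intro n j
    have h := IntSeries.hasValueAt_coeff_transpose (IntSeries.transpose Lt) (hyI1 j) n
    rwa [IntSeries.transpose_transpose] at h
  -- §2c. an outer index `n₀` with `[T₁^{n₀}]L ≠ 0` and a node where it does not vanish
  obtain ⟨n₀, hn₀⟩ : ∃ n₀ : ℕ, coeff n₀ Lt ≠ 0 := by
    by_contra hall
    push Not at hall
    exact hLt0 (PowerSeries.ext fun n ↦ by rw [hall n, map_zero])
  obtain ⟨j₀, hj₀⟩ : ∃ j₀ : ℕ, lv n₀ j₀ ≠ 0 := by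
    by_contra hall
    push Not at hall
    apply hn₀
    refine IntSeries.eq_zero_of_infinite_zeros h30 h31 ((Set.infinite_range_of_injective hinjy).mono ?_)
    rintro _ ⟨j, rfl⟩
    exact ⟨hyϖ j, by simpa only [hall j] using hlval n₀ j⟩
  -- §2d. the two one-variable integral `ℂ_p`-series and their node values
  set f : PowerSeries ℂ_[p] := PowerSeries.mk fun k ↦ ((coeff k (coeff n₀ Lt) : PadicComplexInt p) : ℂ_[p]) with hf
  set g : PowerSeries ℂ_[p] := PowerSeries.mk fun k ↦ ((coeff k (coeff n₀ Gt) : PadicComplexInt p) : ℂ_[p]) with hg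
  have hfint : ∀ k, ‖coeff k f‖ ≤ 1 := fun k ↦ by
    rw [hf, coeff_mk]; exact mem_padicComplexInt_iff.mp (coeff k (coeff n₀ Lt)).2
  have hgint : ∀ k, ‖coeff k g‖ ≤ 1 := fun k ↦ by
    rw [hg, coeff_mk]; exact mem_padicComplexInt_iff.mp (coeff k (coeff n₀ Gt)).2
  have hfval : ∀ j, ∑' k, coeff k f * y j ^ k = lv n₀ j := fun j ↦ by
    simpa only [hf, coeff_mk] using (hlval n₀ j).tsum_eq
  have hgval' : ∀ j, ∑' k, coeff k g * y j ^ k = gv n₀ j := fun j ↦ by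
    simpa only [hg, coeff_mk] using (hgval n₀ j).tsum_eq
  -- beyond an index `j₁` all node values of `f` are non-zero
  obtain ⟨j₁, hj₁⟩ := NodeSeries.exists_forall_le_ne_zero hfint hc0 h31 hinjy hyϖ (i₀ := j₀) (by rw [hfval]; exact hj₀)
  have hfne : ∀ t : ℕ, lv n₀ (j₁ + t) ≠ 0 := fun t ↦ by rw [← hfval]; exact hj₁ _ (Nat.le_add_right _ _)
  -- §2e. re-centre both at the node `j₁`
  set a : ℂ_[p] := v₂ ^ (j₁ + 1) with ha_def
  have hξ : ‖a - 1‖ ≤ ‖(p : ℂ_[p])‖ := hyϖ j₁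
  have ha1 : ‖a‖ ≤ 1 := RamifiedSevenEllipticUnits.LemmaXi.norm_le_one_of_norm_sub_one_le_one (hξ.trans h31.le)
  obtain ⟨H, hHint, hHval⟩ := NodeSeries.exists_recenter_rescale hfint hc0 h31 hξ ha1
  obtain ⟨H', hH'int, hH'val⟩ := NodeSeries.exists_recenter_rescale hgint hc0 h31 hξ ha1
  have hnode : ∀ t : ℕ, a * (v₂ ^ t - 1) + (a - 1) = y (j₁ + t) := fun t ↦ by
    simp only [ha_def, hy_def]; ring
  have hHL : ∀ t : ℕ, ∑' n, coeff n H * (v₂ ^ t - 1) ^ n = lv n₀ (j₁ + t) := fun t ↦ by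
    rw [hHval _ (hvt1 t), hnode, hfval]
  have hHG : ∀ t : ℕ, ∑' n, coeff n H' * (v₂ ^ t - 1) ^ n = gv n₀ (j₁ + t) := fun t ↦ by
    rw [hH'val _ (hvt1 t), hnode, hgval']
  -- the node relation `H′(v₂ᵗ − 1) = w^{j₁+1} · wᵗ · H(v₂ᵗ − 1)`
  set c₀ : ℂ_[p] := w ^ (j₁ + 1) with hc₀
  have hc₀0 : c₀ ≠ 0 := pow_ne_zero _ hw0
  have hrelt : ∀ t : ℕ, ∑' n, coeff n H' * (v₂ ^ t - 1) ^ n = c₀ * w ^ t * ∑' n, coeff n H * (v₂ ^ t - 1) ^ n := by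
    intro t
    rw [hHL, hHG, hrel, hc₀, ← pow_add, show j₁ + t + 1 = j₁ + 1 + t by ring]
  -- §2f. the `ℂ_p` node theorem in the second variable (base `v₂`)
  have h00 : ∑' n, coeff n H * (v₂ ^ 0 - 1) ^ n ≠ 0 := by rw [hHL]; exact hfne 0
  obtain ⟨e, Q, hHQ, hODE, hQbd⟩ :=
    PadicComplex.exists_padicInt_binomial_twist_of_node_values hHint hH'int (hv₂.trans h31) hv₂t hc₀0 hw0 hrelt h00
  -- evaluate `H′ = Q·H` at the nodes: `Q(v₂ᵗ − 1) = c₀·wᵗ`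
  have hQres : IsRestricted ‖(p : ℂ_[p])‖ Q := isRestricted_of_norm_coeff_le hQbd hc0.le h31
  have hHres : IsRestricted ‖(p : ℂ_[p])‖ H := isRestricted_of_norm_coeff_le hHint hc0.le h31
  have hQt : ∀ t : ℕ, ∑' n, coeff n Q * (v₂ ^ t - 1) ^ n = c₀ * w ^ t := by
    intro t
    have h1 : (∑' n, coeff n Q * (v₂ ^ t - 1) ^ n) * lv n₀ (j₁ + t) = c₀ * w ^ t * lv n₀ (j₁ + t) := by
      rw [← hHL t, ← tsum_coeff_mul hQres hHres (hvt1 t), ← hHQ, hrelt t]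
    exact mul_right_cancel₀ (hfne t) h1
  have hQ0 : constantCoeff Q = c₀ := by
    have h := hQt 0
    rwa [pow_zero, sub_self, pow_zero, mul_one, tsum_coeff_mul_zero_pow] at h
  have hQ1 : ∑' n, coeff n Q * (v₂ - 1) ^ n = c₀ * w := by simpa using hQt 1
  -- normalise `Q` by its constant term
  refine ⟨e, C c₀⁻¹ * Q, ?_, ?_, ?_, ?_⟩
  · rw [Derivation.leibniz, derivative_C, smul_zero, add_zero, smul_eq_mul, ← mul_assoc, mul_comm (1 + X), mul_assoc, hODE]
    ring
  · rw [map_mul, constantCoeff_C, hQ0, inv_mul_cancel₀ hc₀0]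
  · intro n
    rw [coeff_C_mul, norm_mul, norm_inv]
    calc ‖c₀‖⁻¹ * ‖coeff n Q‖ ≤ ‖c₀‖⁻¹ * ‖c₀‖ := by
          gcongr; rw [← hQ0]; exact hQbd n
      _ = 1 := inv_mul_cancel₀ (norm_ne_zero_iff.mpr hc₀0)
  · have hsum := (summable_coeff_mul_pow hQres (x := v₂ - 1) (hvt1 1 |>.trans_eq' (by rw [pow_one]))).hasSum
    rw [hQ1] at hsum
    have h2 := hsum.mul_left c₀⁻¹
    rw [inv_mul_cancel_left₀ hc₀0] at h2
    refine h2.congr_fun fun n ↦ ?_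
    rw [coeff_C_mul, mul_assoc]

end Summit.BirchSwinnertonDyer.BirchSwinnertonDyer.Theorems.UniversalToricDescentThinComb.ColumnTwist

end
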